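import Literature.NumberTheory.Automorphic.JacquetLemmaGLProofs
import Literature.NumberTheory.Automorphic.PAdicRepsJacquetAdmissibilityHolds
import HarnessLib

/-!
# Jacquet modules of irreducible representations of `GL_n(F)` are admissible: the discharge

This sibling file of `ParabolicInduction` discharges the named fact
`Literature.NumberTheory.Automorphic.jacquetGL_isAdmissible F c` (for an irreducible smooth
complex representation `π` of `GL_n(F)`, `F` a non-archimedean local field, and every standard
parabolic `P_c`, the Jacquet module `r_c π = Representation.jacquetGL F c π` is an admissible
representation of `Π_a GL_{n_a}(F)`; Jacquet 1975; Bernstein–Zelevinsky 1977, Thm. 2.5 with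
Prop. 2.3 (e)). As recorded in the docstring of the fact and in
`Literature.NumberTheory.Automorphic.ParabolicInductionAdmissibleProofs`, it is the composite of

* **Jacquet's admissibility theorem** (lang.S16), `jacquetAdmissibility_gl_holds`
  (file `PAdicRepsJacquetAdmissibilityHolds`; Bernstein–Zelevinsky 1976, Theorem 3.25), and
* **Jacquet's lemma for `GL_n(F)`**, `Representation.isAdmissible_jacquetGL_holds`
  (file `JacquetLemmaGLProofs`; Bernstein–Zelevinsky 1977, §2.3 Proposition (e)),

through the reduction `jacquetGL_isAdmissible_of` (file `ParabolicInductionAdmissibleProofs`,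
which closes the gaps of index type and universe). It is a separate leaf module because
`ParabolicInductionAdmissibleProofs` is imported by `ParabolicGLReindex`, itself imported by
`JacquetLemmaGLProofs`. Theorems only; no definition, no new named fact.

## References

* H. Jacquet, *Sur les représentations des groupes réductifs p-adiques*, C. R. Acad. Sci. Paris
  280 (1975), 1271–1272.
* I. N. Bernstein, A. V. Zelevinsky, *Induced representations of reductive 𝔭-adic groups. I*,
  Ann. Sci. ÉNS (4) 10 (1977), 441–472, Thm. 2.5 and §2.3 Proposition (e).
-/

open scoped MatrixGroups

namespace Literature.NumberTheory.Automorphic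

universe u v

/-- **Jacquet modules of irreducible smooth representations of `GL_n(F)` are admissible** —
discharge of the named fact `jacquetGL_isAdmissible` (file `ParabolicInduction`): for a
non-archimedean local field `F`, any finite index type `n`, any block labelling `c : n → α` and
any irreducible smooth complex representation `π` of `GL_n(F)` (on a space `V` in any universe),
the Jacquet module `r_c π` is an admissible representation of `Π_a GL_{n_a}(F)`. Proof:
`jacquetGL_isAdmissible_of` applied to Jacquet's admissibility theorem
`jacquetAdmissibility_gl_holds` and Jacquet's lemma `Representation.isAdmissible_jacquetGL_holds`.
The binders are exactly the parameters of the fact (`F` with its instances, `n`, `α`, `c`, and the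
representation space `V` with its instances); there is no hypothesis.
(Jacquet 1975; Bernstein–Zelevinsky 1977, Thm. 2.5 with Prop. 2.3 (e).) [cite: Jacquet1975] -/
theorem jacquetGL_isAdmissible_holds (F : Type u) [Field F] [ValuativeRel F] [TopologicalSpace F]
    [IsNonarchimedeanLocalField F] {n : Type*} [Fintype n] [DecidableEq n] {α : Type*}
    [LinearOrder α] [Fintype α] (c : n → α) {V : Type v} [AddCommGroup V] [Module ℂ V] :
    jacquetGL_isAdmissible F c (V := V) :=
  jacquetGL_isAdmissible_of F c (jacquetAdmissibility_gl_holds F)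
    (Representation.isAdmissible_jacquetGL_holds F c)

end Literature.NumberTheory.Automorphic
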